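import Literature.AlgebraicGeometry.Motives.MixedHodgeStructureLoewySeriesAdditive
import Literature.AlgebraicGeometry.Motives.MixedHodgeStructureKrullSchmidtCancellation
import HarnessLib

/-!
# The Loewy series of an internal direct sum of mixed Hodge structures

For objects of finite length of an abelian category — here mixed Hodge structures on finite-dimensional `ℚ`-spaces
(Cattani–El Zein–Griffiths–Lê, Thm. 3.2.18, p. 270) — the socle series and the radical series commute with finite
direct sums and the Loewy length of a direct sum is the maximum of the Loewy lengths of the summands
(Anderson–Fuller §32; the tree's `socleSeries_prod`, `radicalSeries_prod`, `loewyLength_prod` treat the external sum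
`H₁ ⊕ H₂`). This file gives the transport of both series along isomorphisms and the INTERNAL versions, for a
decomposition `H = ⊕ᵢ Sᵢ` into an independent spanning family of sub-MHS (via the projections `αᵢ : H → Sᵢ` of
`MixedHodgeStructureKrullSchmidtUniqueness`) and for a pair of complementary sub-MHS `H = S ⊕ T`.
Namespace `MixedHodgeStructure`; everything proved, no named facts:

* §1 `map_socleSeries_eq_of_bijective`, `map_radicalSeries_eq_of_bijective` (and preimage forms);
* §2 **`radicalSeries_eq_iSup`**: `rad^k H = Σᵢ rad^k Sᵢ`, **`socleSeries_eq_iSup`**: `soc^k H = Σᵢ soc^k Sᵢ`,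
  **`loewyLength_eq_sup`**: `ℓ(H) = maxᵢ ℓ(Sᵢ)` for `H = ⊕ᵢ Sᵢ`;
* §3 the two-summand forms for `H = S ⊕ T` (`socleSeries_eq_sup_of_isCompl`, `radicalSeries_eq_sup_of_isCompl`,
  `socle_eq_sup_of_isCompl`, `radical_eq_sup_of_isCompl`, **`loewyLength_eq_max_of_isCompl`**).

## References

* [AndersonFuller1992] F. W. Anderson, K. R. Fuller, Rings and Categories of Modules, 2nd ed. (1992), §32 (p. 346).
* [CattaniElZeinGriffithsLe2014] E. Cattani et al. (eds.), Hodge Theory (2014), Thm. 3.2.18, Lemma 3.2.20, p. 270.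
-/

noncomputable section

namespace Literature.AlgebraicGeometry.Motives

namespace MixedHodgeStructure

universe u v w

variable {V : Type u} [AddCommGroup V] [Module ℚ V] [FiniteDimensional ℚ V]
variable {V' : Type v} [AddCommGroup V'] [Module ℚ V'] [FiniteDimensional ℚ V']
variable {H : MixedHodgeStructure V} {H' : MixedHodgeStructure V'}

open Module SubMixedHodgeStructure

/-! ### §1 Both Loewy series are transported along isomorphisms -/

/-- An isomorphism maps `soc^k` onto `soc^k`. [cite: AndersonFuller1992, §32 (p. 346)] [cite: CattaniElZeinGriffithsLe2014, Thm. 3.2.18] -/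
theorem map_socleSeries_eq_of_bijective (f : Hom H H') (hf : Function.Bijective f.toLinearMap) (k : ℕ) :
    (socleSeries H k).toSubmodule.map f.toLinearMap = (socleSeries H' k).toSubmodule := by
  refine le_antisymm (f.map_socleSeries_le k) fun y hy => ?_
  refine ⟨(f.inverse hf).toLinearMap y, (f.inverse hf).apply_mem_socleSeries hy, ?_⟩
  rw [← LinearMap.comp_apply, ← Hom.comp_toLinearMap, Hom.comp_inverse, Hom.id_toLinearMap, LinearMap.id_apply]

/-- An isomorphism maps `rad^k` onto `rad^k`. [cite: AndersonFuller1992, §32 (p. 346)] [cite: CattaniElZeinGriffithsLe2014, Thm. 3.2.18] -/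
theorem map_radicalSeries_eq_of_bijective (f : Hom H H') (hf : Function.Bijective f.toLinearMap) (k : ℕ) :
    (radicalSeries H k).toSubmodule.map f.toLinearMap = (radicalSeries H' k).toSubmodule := by
  refine le_antisymm (f.map_radicalSeries_le k) fun y hy => ?_
  refine ⟨(f.inverse hf).toLinearMap y, (f.inverse hf).apply_mem_radicalSeries hy, ?_⟩
  rw [← LinearMap.comp_apply, ← Hom.comp_toLinearMap, Hom.comp_inverse, Hom.id_toLinearMap, LinearMap.id_apply]

/-- Preimage form: `f⁻¹(soc^k H') = soc^k H` for an isomorphism `f`. [cite: AndersonFuller1992, §32 (p. 346)] -/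
theorem comap_socleSeries_eq_of_bijective (f : Hom H H') (hf : Function.Bijective f.toLinearMap) (k : ℕ) :
    (socleSeries H' k).toSubmodule.comap f.toLinearMap = (socleSeries H k).toSubmodule := by
  rw [← map_socleSeries_eq_of_bijective f hf k, Submodule.comap_map_eq_of_injective hf.1]

/-- Preimage form: `f⁻¹(rad^k H') = rad^k H` for an isomorphism `f`. [cite: AndersonFuller1992, §32 (p. 346)] -/
theorem comap_radicalSeries_eq_of_bijective (f : Hom H H') (hf : Function.Bijective f.toLinearMap) (k : ℕ) :
    (radicalSeries H' k).toSubmodule.comap f.toLinearMap = (radicalSeries H k).toSubmodule := by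
  rw [← map_radicalSeries_eq_of_bijective f hf k, Submodule.comap_map_eq_of_injective hf.1]

/-! ### §2 Internal direct sums `H = ⊕ᵢ Sᵢ` -/

section Family

variable {ι : Type w} (S : ι → SubMixedHodgeStructure H)

/-- `Σᵢ rad^k Sᵢ ⊆ rad^k H` for any family of sub-MHS (functoriality along `Sᵢ ↪ H`).
[cite: AndersonFuller1992, §32 (p. 346)] [cite: CattaniElZeinGriffithsLe2014, p. 270] -/
theorem iSup_map_radicalSeries_le (k : ℕ) :
    (⨆ i, (radicalSeries (S i).toMixedHodgeStructure k).toSubmodule.map (S i).toSubmodule.subtype) ≤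
      (radicalSeries H k).toSubmodule :=
  iSup_le fun i => (S i).subtype.map_radicalSeries_le k

/-- `Σᵢ soc^k Sᵢ ⊆ soc^k H` for any family of sub-MHS. [cite: AndersonFuller1992, §32 (p. 346)] [cite: CattaniElZeinGriffithsLe2014, p. 270] -/
theorem iSup_map_socleSeries_le (k : ℕ) :
    (⨆ i, (socleSeries (S i).toMixedHodgeStructure k).toSubmodule.map (S i).toSubmodule.subtype) ≤
      (socleSeries H k).toSubmodule :=
  iSup_le fun i => (S i).subtype.map_socleSeries_le k

variable [Fintype ι] (hS : iSupIndep fun i => (S i).toSubmodule) (hS' : (⨆ i, (S i).toSubmodule) = ⊤)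
include hS hS'

/-- **`rad^k H = Σᵢ rad^k Sᵢ` for `H = ⊕ᵢ Sᵢ`**: `x = Σᵢ αᵢ x` with `αᵢ(rad^k H) ⊆ rad^k Sᵢ`.
[cite: AndersonFuller1992, §32 (p. 346)] [cite: CattaniElZeinGriffithsLe2014, p. 270] -/
theorem radicalSeries_eq_iSup (k : ℕ) : (radicalSeries H k).toSubmodule =
    ⨆ i, (radicalSeries (S i).toMixedHodgeStructure k).toSubmodule.map (S i).toSubmodule.subtype := by
  classical
  refine le_antisymm (fun x hx => ?_) (iSup_map_radicalSeries_le S k)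
  rw [← sum_coe_proj_apply S hS hS' x]
  refine Submodule.sum_mem _ fun i _ => Submodule.mem_iSup_of_mem i ?_
  exact ⟨(proj S hS hS' i).toLinearMap x, (proj S hS hS' i).apply_mem_radicalSeries hx, rfl⟩

/-- **`soc^k H = Σᵢ soc^k Sᵢ` for `H = ⊕ᵢ Sᵢ`.** [cite: AndersonFuller1992, §32 (p. 346)] [cite: CattaniElZeinGriffithsLe2014, p. 270] -/
theorem socleSeries_eq_iSup (k : ℕ) : (socleSeries H k).toSubmodule =
    ⨆ i, (socleSeries (S i).toMixedHodgeStructure k).toSubmodule.map (S i).toSubmodule.subtype := by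
  classical
  refine le_antisymm (fun x hx => ?_) (iSup_map_socleSeries_le S k)
  rw [← sum_coe_proj_apply S hS hS' x]
  refine Submodule.sum_mem _ fun i _ => Submodule.mem_iSup_of_mem i ?_
  exact ⟨(proj S hS hS' i).toLinearMap x, (proj S hS hS' i).apply_mem_socleSeries hx, rfl⟩

/-- `soc H = Σᵢ soc Sᵢ` for `H = ⊕ᵢ Sᵢ`. [cite: AndersonFuller1992, §32 (p. 346)] [cite: CattaniElZeinGriffithsLe2014, p. 270] -/
theorem socle_eq_iSup : (socle H).toSubmodule =
    ⨆ i, (socle (S i).toMixedHodgeStructure).toSubmodule.map (S i).toSubmodule.subtype := by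
  have h := socleSeries_eq_iSup S hS hS' 1
  simp only [socleSeries_one] at h
  exact h

/-- `rad H = Σᵢ rad Sᵢ` for `H = ⊕ᵢ Sᵢ`. [cite: AndersonFuller1992, §32 (p. 346)] [cite: CattaniElZeinGriffithsLe2014, p. 270] -/
theorem radical_eq_iSup : (radical H).toSubmodule =
    ⨆ i, (radical (S i).toMixedHodgeStructure).toSubmodule.map (S i).toSubmodule.subtype := by
  have h := radicalSeries_eq_iSup S hS hS' 1
  simp only [radicalSeries_one] at h
  exact h

/-- **`ℓ(H) = maxᵢ ℓ(Sᵢ)` for `H = ⊕ᵢ Sᵢ`.** [cite: AndersonFuller1992, §32 (p. 346)] [cite: CattaniElZeinGriffithsLe2014, p. 270] -/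
theorem loewyLength_eq_sup : loewyLength H = Finset.univ.sup fun i => loewyLength (S i).toMixedHodgeStructure := by
  classical
  refine le_antisymm ?_ (Finset.sup_le fun i _ => (S i).loewyLength_le)
  rw [loewyLength_le_iff_radicalSeries_eq_bot, radicalSeries_eq_iSup S hS hS', iSup_eq_bot]
  intro i
  rw [radicalSeries_eq_bot_of_le (S i).toMixedHodgeStructure
    (Finset.le_sup (f := fun i => loewyLength (S i).toMixedHodgeStructure) (Finset.mem_univ i))
    radicalSeries_loewyLength_eq_bot, Submodule.map_bot]

/-- `rad^k H = 0 ↔ rad^k Sᵢ = 0` for all `i` (`H = ⊕ᵢ Sᵢ`). [cite: AndersonFuller1992, §32 (p. 346)] -/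
theorem radicalSeries_eq_bot_iff_forall (k : ℕ) : (radicalSeries H k).toSubmodule = ⊥ ↔
    ∀ i, (radicalSeries (S i).toMixedHodgeStructure k).toSubmodule = ⊥ := by
  rw [radicalSeries_eq_iSup S hS hS', iSup_eq_bot]
  refine forall_congr' fun i => ⟨fun h => ?_, fun h => by rw [h, Submodule.map_bot]⟩
  exact (Submodule.map_injective_of_injective (Submodule.injective_subtype _)) (h.trans (Submodule.map_bot _).symm)

/-- `soc^k H = H ↔ soc^k Sᵢ = Sᵢ` for all `i` (`H = ⊕ᵢ Sᵢ`). [cite: AndersonFuller1992, §32 (p. 346)] -/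
theorem socleSeries_eq_top_iff_forall (k : ℕ) : (socleSeries H k).toSubmodule = ⊤ ↔
    ∀ i, (socleSeries (S i).toMixedHodgeStructure k).toSubmodule = ⊤ := by
  rw [socleSeries_eq_top_iff_radicalSeries_eq_bot, radicalSeries_eq_bot_iff_forall S hS hS']
  exact forall_congr' fun i => (socleSeries_eq_top_iff_radicalSeries_eq_bot k).symm

end Family

/-! ### §3 Two complementary sub-MHS `H = S ⊕ T` -/

section Internal

variable (S T : SubMixedHodgeStructure H) (hST : IsCompl S.toSubmodule T.toSubmodule)
include hST

/-- **`soc^k H = soc^k S + soc^k T`** for `H = S ⊕ T`. [cite: AndersonFuller1992, §32 (p. 346)] [cite: CattaniElZeinGriffithsLe2014, p. 270] -/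
theorem socleSeries_eq_sup_of_isCompl (k : ℕ) : (socleSeries H k).toSubmodule =
    (socleSeries S.toMixedHodgeStructure k).toSubmodule.map S.toSubmodule.subtype ⊔
      (socleSeries T.toMixedHodgeStructure k).toSubmodule.map T.toSubmodule.subtype := by
  rw [← map_socleSeries_eq_of_bijective _ (bijective_coprodDesc_subtype_of_isCompl S T hST) k, socleSeries_prod,
    Hom.coprodDesc_toLinearMap, LinearMap.map_coprod_prod]
  rfl

/-- **`rad^k H = rad^k S + rad^k T`** for `H = S ⊕ T`. [cite: AndersonFuller1992, §32 (p. 346)] [cite: CattaniElZeinGriffithsLe2014, p. 270] -/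
theorem radicalSeries_eq_sup_of_isCompl (k : ℕ) : (radicalSeries H k).toSubmodule =
    (radicalSeries S.toMixedHodgeStructure k).toSubmodule.map S.toSubmodule.subtype ⊔
      (radicalSeries T.toMixedHodgeStructure k).toSubmodule.map T.toSubmodule.subtype := by
  rw [← map_radicalSeries_eq_of_bijective _ (bijective_coprodDesc_subtype_of_isCompl S T hST) k, radicalSeries_prod,
    Hom.coprodDesc_toLinearMap, LinearMap.map_coprod_prod]
  rfl

/-- `soc H = soc S + soc T` for `H = S ⊕ T`. [cite: AndersonFuller1992, §32 (p. 346)] [cite: CattaniElZeinGriffithsLe2014, p. 270] -/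
theorem socle_eq_sup_of_isCompl : (socle H).toSubmodule =
    (socle S.toMixedHodgeStructure).toSubmodule.map S.toSubmodule.subtype ⊔
      (socle T.toMixedHodgeStructure).toSubmodule.map T.toSubmodule.subtype := by
  have h := socleSeries_eq_sup_of_isCompl S T hST 1
  simp only [socleSeries_one] at h
  exact h

/-- `rad H = rad S + rad T` for `H = S ⊕ T`. [cite: AndersonFuller1992, §32 (p. 346)] [cite: CattaniElZeinGriffithsLe2014, p. 270] -/
theorem radical_eq_sup_of_isCompl : (radical H).toSubmodule =
    (radical S.toMixedHodgeStructure).toSubmodule.map S.toSubmodule.subtype ⊔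
      (radical T.toMixedHodgeStructure).toSubmodule.map T.toSubmodule.subtype := by
  have h := radicalSeries_eq_sup_of_isCompl S T hST 1
  simp only [radicalSeries_one] at h
  exact h

/-- **`ℓ(H) = max (ℓ S) (ℓ T)`** for `H = S ⊕ T`. [cite: AndersonFuller1992, §32 (p. 346)] [cite: CattaniElZeinGriffithsLe2014, p. 270] -/
theorem loewyLength_eq_max_of_isCompl :
    loewyLength H = max (loewyLength S.toMixedHodgeStructure) (loewyLength T.toMixedHodgeStructure) := by
  rw [← loewyLength_prod]
  exact ((Hom.coprodDesc S.subtype T.subtype).loewyLength_eq_of_bijective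
    (bijective_coprodDesc_subtype_of_isCompl S T hST)).symm

/-- Hence `H = S ⊕ T` is semisimple iff `S` and `T` are (`ℓ ≤ 1`; cf. the tree's `IsSemisimple.of_isCompl`).
[cite: CattaniElZeinGriffithsLe2014, p. 270] -/
theorem isSemisimple_iff_of_isCompl :
    H.IsSemisimple ↔ S.toMixedHodgeStructure.IsSemisimple ∧ T.toMixedHodgeStructure.IsSemisimple := by
  rw [← loewyLength_le_one_iff, ← loewyLength_le_one_iff, ← loewyLength_le_one_iff,
    loewyLength_eq_max_of_isCompl S T hST, max_le_iff]

end Internal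

end MixedHodgeStructure

end Literature.AlgebraicGeometry.Motives
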